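import Summits.QuantumFields.YangMills.Theorems.BalabanUVNodesN18KingModelLargeField

/-!
# BalabanUVNodes ∕ node N19 (NE7 bracket) — THE ANNEALED (TILT-PATH) ROAD, GAUSSIAN CHAPTER I: Feynman–Hellmann along an affine path of coercive quadratic actions on
# the unit-lattice field space `Tor M → ℝ`, and EQUIPARTITION `∫ (φ·Δφ)e^{−½φ·Δφ}dφ = |Tor M|·∫ e^{−½φ·Δφ}dφ`

Cell `pub-ymgap`, HUMAN RULING D-0062 (Track A), R134 ACCELERATION seat `pub-ymgap-dag-n19-c` (N19 NE7, strategy s1), generation 12, module 19a-I; route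
`Summits/QuantumFields/YangMills/Theses/BalabanUVNodes.lean` rev 19 (K3⁗ `SpineGivenEndpointR13Sep` = stmt-QuantumFields-20292, `--supports … --as helper`); venue R424
(namespace `Summit.QuantumFields.YangMills.BalabanUVNodes.N19TiltPathGaussian`).  ADDITIVE — imports n14-c's `…N18KingModelLargeField` (p512255: the field space `Tor M → ℝ` with
Lebesgue measure, `QGQInverse.Coercive`, ★ `integrable_exp_neg_action`, `dotProduct_mulVec_smul`, `dotProduct_self_eq_sum_sq`; through it `…KingModelDensTorus`
(`measurable_dotProduct_mulVec`), `HornerSymmetrizer` (`dotProduct_self_nonneg_real`) and the whole of Mathlib) — all CITED, nothing re-proved; THEOREMS ONLY (0 `def`), modifies nothing.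

WHY (the door, bus INTENT-19 l.17921; dag-lead DEDUP l.17935 GO; n14-c NO-OVERLAP∕GO l.18000).  This seat's g9 modules (`…N19TiltPathCalculus` p508225, `…TiltPathEndpoints` p508812,
`…TiltPathRoad` p509274) proved the ANNEALED ROAD at the class level: joining two runs by a C¹ exponential family, Feynman–Hellmann turns a DRIFT bound on the path derivative into
NE7's matching-modulo-constants — there for tilts with a BOUNDED exponent derivative.  n14-c's `…N18KingModelLargeField` put a CONCRETE two-run tower in the tree: King's full-space
Gaussian effective measures `e^{−½φ·Δ^{(k)}φ}dφ`, `γ₀`-coercive, with `|½φ·Δ^{(k)}φ − ½φ·Δ^{(k+1)}φ| ≤ θ_k·a·(φ·φ)∕2` (`abs_action_sub_le_torus`), and closed the apex Cauchy statement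
there under a volume-exponential LARGE-FIELD NUMERIC CONDITION (the DENS road needs a small-field box).  Along the straight chord `Δ_u = Δ_A + u(Δ_B − Δ_A)` the exponent derivative
`−½φ·Dφ` is UNBOUNDED but Gaussian-integrable, and the annealed road closes with NO condition at all (`…N19TiltPathGaussianTwoRuns`, `…N19TiltPathKingModel`).  This file: the calculus.
* §1 [folklore] quadratic-form algebra: `sq_le_dotProduct_self`, `abs_dotProduct_mulVec_le` (`|φ·Dφ| ≤ (Σ|D_xy|)·φ·φ`), `dotProduct_add_smul_mulVec`, `dotProduct_smul_mulVec`,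
  `dotProduct_sub_mulVec`, `coercive_chord` (convexity), `coercive_smul_one`, `integrable_exp_neg_mul_dotProduct`, `mul_exp_neg_le` (`s·e^{−γs∕2} ≤ (4∕γ)e^{−γs∕4}`), `exp_mul_mem`.
* §2 [folklore] ★ `abs_deriv_integrand_le` (the Gaussian majorant of `−½φ·Dφ·e^{−½φ·Δφ}·g`), `integrable_deriv_integrand`, ★★ **`hasDerivAt_integral_exp_neg_pathAction`** (FEYNMAN–
  HELLMANN along an affine matrix path at a point with a coercive neighbourhood, bounded measurable weight; Mathlib `hasDerivAt_integral_of_dominated_loc_of_deriv_le`),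
  `continuousOn_integral_exp_neg_pathAction` (Mathlib `continuousOn_of_dominated`).
* §3 [folklore] ★★ **`integral_action_mul_exp_neg_action`** — EQUIPARTITION: the Gaussian mean of the action is the number of degrees of freedom (scaling `∫e^{−c²S∕2} = c^{−n}∫e^{−S∕2}`
  by Mathlib `Measure.integral_comp_smul` — n14-c's `integral_exp_neg_quarter_action` device, the `c = √2⁻¹` instance — differentiated at `c = 1` against §2 and `HasDerivAt.unique`).

HONEST FRAMING.  Finite-dimensional Gaussian calculus [folklore]; the intended consumer is King's `A = 0` scalar MODEL (template literature) — NOT Bałaban's NE7 (NOT PRINTED;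
NODE O's objects): in the non-Gaussian procedure the action difference is NOT second-moment-small on large fields, which is exactly why NE7b exists.  Count-neutral; N18 ∕ N19 ∕ N20 ∕
N27 NOT discharged; counts UNMOVED.  Everything is PROVED (0 `sorry`, 0 named facts).  One finite four-torus programme at fixed ε; NOT ℝ⁴, NOT OS, NOT a mass gap, NOT Clay.
-/

noncomputable section

namespace Summit.QuantumFields.YangMills.BalabanUVNodes.N19TiltPathGaussian

open MeasureTheory Set Filter Real Matrix Topology
open scoped BigOperators
open Literature.MathematicalPhysics.QuantumFieldTheory.Balaban1983to89.B5Prop11Plancherel (Tor)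
open Literature.MathematicalPhysics.QuantumFieldTheory.Balaban1983to89.QGQInverse (Coercive)
open Literature.LinearAlgebra.Matrix (dotProduct_self_nonneg_real)
open YMDAG.N18.KingModelLargeField (integrable_exp_neg_action integrable_dressed dressedZ_full_pos dotProduct_mulVec_smul dotProduct_self_eq_sum_sq)
open YMDAG.N18.KingModelDensTorus (measurable_dotProduct_mulVec)

variable {d : ℕ} (M : Fin d → ℕ) [hM : ∀ μ, NeZero (M μ)]

/-! ## §1 Quadratic-form algebra on the unit-lattice field space `Tor M → ℝ` -/
section Algebra

/-- One coordinate square is below the Euclidean square norm: `φ(x)² ≤ φ·φ`. [folklore] -/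
theorem sq_le_dotProduct_self (φ : Tor M → ℝ) (x : Tor M) : φ x ^ 2 ≤ φ ⬝ᵥ φ := by
  rw [dotProduct_self_eq_sum_sq M φ]
  exact Finset.single_le_sum (fun y _ => sq_nonneg (φ y)) (Finset.mem_univ x)

/-- A crude but hypothesis-free form bound: `|φ·Dφ| ≤ (Σ_{x,y}|D_{xy}|)·(φ·φ)` for EVERY real matrix on a finite lattice. [folklore] -/
theorem abs_dotProduct_mulVec_le (D : Matrix (Tor M) (Tor M) ℝ) (φ : Tor M → ℝ) :
    |φ ⬝ᵥ (D *ᵥ φ)| ≤ (∑ x, ∑ y, |D x y|) * (φ ⬝ᵥ φ) := by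
  have h2 : ∀ x y : Tor M, |φ x| * |φ y| ≤ φ ⬝ᵥ φ := fun x y => by
    have hxy := two_mul_le_add_sq (|φ x|) (|φ y|)
    rw [sq_abs, sq_abs] at hxy
    have hx := sq_le_dotProduct_self M φ x
    have hy := sq_le_dotProduct_self M φ y
    nlinarith [abs_nonneg (φ x), abs_nonneg (φ y)]
  calc |φ ⬝ᵥ (D *ᵥ φ)| = |∑ x, ∑ y, φ x * (D x y * φ y)| := by
        simp only [dotProduct, Matrix.mulVec, Finset.mul_sum]
    _ ≤ ∑ x, ∑ y, |D x y| * (|φ x| * |φ y|) := by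
        refine (Finset.abs_sum_le_sum_abs _ _).trans (Finset.sum_le_sum fun x _ =>
          (Finset.abs_sum_le_sum_abs _ _).trans (Finset.sum_le_sum fun y _ => le_of_eq ?_))
        rw [abs_mul, abs_mul]
        ring
    _ ≤ ∑ x, ∑ y, |D x y| * (φ ⬝ᵥ φ) :=
        Finset.sum_le_sum fun x _ => Finset.sum_le_sum fun y _ => mul_le_mul_of_nonneg_left (h2 x y) (abs_nonneg _)
    _ = (∑ x, ∑ y, |D x y|) * (φ ⬝ᵥ φ) := by
        rw [Finset.sum_mul]
        exact Finset.sum_congr rfl fun x _ => (Finset.sum_mul _ _ _).symm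

/-- The action along an AFFINE MATRIX PATH: `φ·(Δ + uD)φ = φ·Δφ + u·(φ·Dφ)`. [folklore] -/
theorem dotProduct_add_smul_mulVec (Δ D : Matrix (Tor M) (Tor M) ℝ) (u : ℝ) (φ : Tor M → ℝ) :
    φ ⬝ᵥ ((Δ + u • D) *ᵥ φ) = φ ⬝ᵥ (Δ *ᵥ φ) + u * (φ ⬝ᵥ (D *ᵥ φ)) := by
  rw [Matrix.add_mulVec, Matrix.smul_mulVec, dotProduct_add, dotProduct_smul, smul_eq_mul]

/-- The action along a RAY: `φ·(uΔ)φ = u·(φ·Δφ)`. [folklore] -/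
theorem dotProduct_smul_mulVec (Δ : Matrix (Tor M) (Tor M) ℝ) (u : ℝ) (φ : Tor M → ℝ) :
    φ ⬝ᵥ ((u • Δ) *ᵥ φ) = u * (φ ⬝ᵥ (Δ *ᵥ φ)) := by
  rw [Matrix.smul_mulVec, dotProduct_smul, smul_eq_mul]

/-- The action of a DIFFERENCE: `φ·(Δ_B − Δ_A)φ = φ·Δ_Bφ − φ·Δ_Aφ`. [folklore] -/
theorem dotProduct_sub_mulVec (ΔA ΔB : Matrix (Tor M) (Tor M) ℝ) (φ : Tor M → ℝ) :
    φ ⬝ᵥ ((ΔB - ΔA) *ᵥ φ) = φ ⬝ᵥ (ΔB *ᵥ φ) - φ ⬝ᵥ (ΔA *ᵥ φ) := by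
  rw [Matrix.sub_mulVec, dotProduct_sub]

/-- **COERCIVITY ALONG THE CHORD** [folklore]: if `Δ_A`, `Δ_B` are `γ`-coercive then so is every convex combination `Δ_A + u(Δ_B − Δ_A)`, `u ∈ [0,1]`. -/
theorem coercive_chord {ΔA ΔB : Matrix (Tor M) (Tor M) ℝ} {γ : ℝ} (hA : Coercive ΔA γ) (hB : Coercive ΔB γ) {u : ℝ}
    (hu0 : 0 ≤ u) (hu1 : u ≤ 1) : Coercive (ΔA + u • (ΔB - ΔA)) γ := fun φ => by
  rw [dotProduct_add_smul_mulVec M, dotProduct_sub_mulVec M]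
  have h1 := hA φ
  have h2 := hB φ
  nlinarith [mul_nonneg (sub_nonneg.2 hu1) (sub_nonneg.2 h1), mul_nonneg hu0 (sub_nonneg.2 h2)]

/-- The scalar matrix `c·1` is `c`-coercive (with equality). [folklore] -/
theorem coercive_smul_one (c : ℝ) : Coercive (c • (1 : Matrix (Tor M) (Tor M) ℝ)) c := fun φ =>
  le_of_eq (by rw [Matrix.smul_mulVec, Matrix.one_mulVec, dotProduct_smul, smul_eq_mul])

/-- The ISOTROPIC GAUSSIAN `e^{−c(φ·φ)∕2}`, `c > 0`, is Lebesgue-integrable on the full field space (n14-c's `integrable_exp_neg_action` at `c·1`). [folklore] -/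
theorem integrable_exp_neg_mul_dotProduct {c : ℝ} (hc : 0 < c) :
    Integrable (fun φ : Tor M → ℝ => Real.exp (-(c * (φ ⬝ᵥ φ) / 2))) := by
  refine (integrable_exp_neg_action M hc (coercive_smul_one M c)).congr (Eventually.of_forall fun φ => ?_)
  simp only
  rw [Matrix.smul_mulVec, Matrix.one_mulVec, dotProduct_smul, smul_eq_mul]

/-- The elementary majorant `s·e^{−γs∕2} ≤ (4∕γ)·e^{−γs∕4}` (`γ > 0`, every real `s`; from `x ≤ e^x`). [folklore] -/
theorem mul_exp_neg_le {γ : ℝ} (hγ : 0 < γ) (s : ℝ) :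
    s * Real.exp (-(γ * s / 2)) ≤ 4 / γ * Real.exp (-(γ * s / 4)) := by
  have h1 : γ * s / 4 ≤ Real.exp (γ * s / 4) := by linarith [Real.add_one_le_exp (γ * s / 4)]
  have h2 : s ≤ 4 / γ * Real.exp (γ * s / 4) := by
    rw [div_mul_eq_mul_div, le_div_iff₀ hγ]
    linarith
  calc s * Real.exp (-(γ * s / 2)) ≤ 4 / γ * Real.exp (γ * s / 4) * Real.exp (-(γ * s / 2)) :=
        mul_le_mul_of_nonneg_right h2 (Real.exp_pos _).le
    _ = 4 / γ * Real.exp (-(γ * s / 4)) := by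
        rw [mul_assoc, ← Real.exp_add]
        congr 2
        ring

/-- The dressing weight of a bounded observable lives in `[e^{−|s|B}, e^{|s|B}]`. [folklore] -/
theorem exp_mul_mem {Ω : Type*} {W : Ω → ℝ} {B : ℝ} (hWb : ∀ ω, |W ω| ≤ B) (s : ℝ) (ω : Ω) :
    Real.exp (-(|s| * B)) ≤ Real.exp (s * W ω) ∧ Real.exp (s * W ω) ≤ Real.exp (|s| * B) := by
  have h : |s * W ω| ≤ |s| * B := by
    rw [abs_mul]
    exact mul_le_mul_of_nonneg_left (hWb ω) (abs_nonneg _)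
  exact ⟨Real.exp_le_exp.2 (by linarith [neg_abs_le (s * W ω)]), Real.exp_le_exp.2 (by linarith [le_abs_self (s * W ω)])⟩

end Algebra

/-! ## §2 Feynman–Hellmann along an affine path of coercive quadratic actions -/
section FeynmanHellmann

/-- **★ THE GAUSSIAN MAJORANT OF THE PATH DERIVATIVE** [folklore]: with `Δ` `γ`-coercive (`γ > 0`), `|φ·Dφ| ≤ κ·(φ·φ)` (`κ ≥ 0`) and `|g| ≤ G`,
`|−½(φ·Dφ)·e^{−½φ·Δφ}·g(φ)| ≤ (2κG∕γ)·e^{−(γ∕2)(φ·φ)∕2}` — an integrable isotropic Gaussian, uniform in every such `Δ`. -/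
theorem abs_deriv_integrand_le {Δ D : Matrix (Tor M) (Tor M) ℝ} {γ κ G : ℝ} (hγ : 0 < γ) (hκ : 0 ≤ κ) (hc : Coercive Δ γ)
    (hD : ∀ φ : Tor M → ℝ, |φ ⬝ᵥ (D *ᵥ φ)| ≤ κ * (φ ⬝ᵥ φ)) {g : (Tor M → ℝ) → ℝ} (hgb : ∀ φ, |g φ| ≤ G) (φ : Tor M → ℝ) :
    |-(φ ⬝ᵥ (D *ᵥ φ) / 2) * Real.exp (-(φ ⬝ᵥ (Δ *ᵥ φ) / 2)) * g φ| ≤ 2 * κ * G / γ * Real.exp (-(γ / 2 * (φ ⬝ᵥ φ) / 2)) := by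
  have hG : 0 ≤ G := (abs_nonneg _).trans (hgb φ)
  have hφ : 0 ≤ φ ⬝ᵥ φ := dotProduct_self_nonneg_real φ
  have hS : γ * (φ ⬝ᵥ φ) ≤ φ ⬝ᵥ (Δ *ᵥ φ) := hc φ
  have hκφ : 0 ≤ κ * (φ ⬝ᵥ φ) / 2 := div_nonneg (mul_nonneg hκ hφ) two_pos.le
  rw [abs_mul, abs_mul, abs_neg, abs_div, abs_two, Real.abs_exp]
  calc |φ ⬝ᵥ (D *ᵥ φ)| / 2 * Real.exp (-(φ ⬝ᵥ (Δ *ᵥ φ) / 2)) * |g φ|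
      ≤ κ * (φ ⬝ᵥ φ) / 2 * Real.exp (-(γ * (φ ⬝ᵥ φ) / 2)) * G := by
        refine mul_le_mul (mul_le_mul (div_le_div_of_nonneg_right (hD φ) two_pos.le)
          (Real.exp_le_exp.2 (by linarith)) (Real.exp_pos _).le hκφ) (hgb φ) (abs_nonneg _)
          (mul_nonneg hκφ (Real.exp_pos _).le)
    _ = κ * G / 2 * ((φ ⬝ᵥ φ) * Real.exp (-(γ * (φ ⬝ᵥ φ) / 2))) := by ring
    _ ≤ κ * G / 2 * (4 / γ * Real.exp (-(γ * (φ ⬝ᵥ φ) / 4))) :=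
        mul_le_mul_of_nonneg_left (mul_exp_neg_le hγ _) (div_nonneg (mul_nonneg hκ hG) two_pos.le)
    _ = 2 * κ * G / γ * Real.exp (-(γ / 2 * (φ ⬝ᵥ φ) / 2)) := by
        rw [show -(γ / 2 * (φ ⬝ᵥ φ) / 2) = -(γ * (φ ⬝ᵥ φ) / 4) by ring]
        ring

/-- The path-derivative integrand `−½(φ·Dφ)·e^{−½φ·Δφ}·g(φ)` is Lebesgue-integrable (bounded measurable `g`, `Δ` coercive, `|φ·Dφ| ≤ κφ·φ`). [folklore] -/
theorem integrable_deriv_integrand {Δ D : Matrix (Tor M) (Tor M) ℝ} {γ κ G : ℝ} (hγ : 0 < γ) (hκ : 0 ≤ κ) (hc : Coercive Δ γ)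
    (hD : ∀ φ : Tor M → ℝ, |φ ⬝ᵥ (D *ᵥ φ)| ≤ κ * (φ ⬝ᵥ φ)) {g : (Tor M → ℝ) → ℝ} (hgm : Measurable g) (hgb : ∀ φ, |g φ| ≤ G) :
    Integrable (fun φ : Tor M → ℝ => -(φ ⬝ᵥ (D *ᵥ φ) / 2) * Real.exp (-(φ ⬝ᵥ (Δ *ᵥ φ) / 2)) * g φ) := by
  refine ((integrable_exp_neg_mul_dotProduct M (half_pos hγ)).const_mul (2 * κ * G / γ)).mono'
    (((((measurable_dotProduct_mulVec M D).div_const 2).neg).mul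
      (Real.measurable_exp.comp ((measurable_dotProduct_mulVec M Δ).div_const 2).neg)).mul hgm).aestronglyMeasurable
    (Eventually.of_forall fun φ => ?_)
  rw [Real.norm_eq_abs]
  exact abs_deriv_integrand_le M hγ hκ hc hD hgb φ

/-- **★★ FEYNMAN–HELLMANN ALONG AN AFFINE PATH OF COERCIVE QUADRATIC ACTIONS** [folklore; Mathlib `hasDerivAt_integral_of_dominated_loc_of_deriv_le`].  `Δ + uD` `γ`-coercive for every `u`
in a neighbourhood `s` of `u₀` (`γ > 0`), `|φ·Dφ| ≤ κφ·φ`, `g` bounded measurable.  Then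
`d∕du ∫ e^{−½φ·(Δ+uD)φ} g(φ) dφ |_{u₀} = ∫ (−½φ·Dφ) e^{−½φ·(Δ+u₀D)φ} g(φ) dφ` (dominated differentiation with the Gaussian majorant of `abs_deriv_integrand_le`). -/
theorem hasDerivAt_integral_exp_neg_pathAction {Δ D : Matrix (Tor M) (Tor M) ℝ} {γ κ G u₀ : ℝ} {s : Set ℝ}
    (hγ : 0 < γ) (hκ : 0 ≤ κ) (hs : s ∈ 𝓝 u₀) (hco : ∀ u ∈ s, Coercive (Δ + u • D) γ)
    (hD : ∀ φ : Tor M → ℝ, |φ ⬝ᵥ (D *ᵥ φ)| ≤ κ * (φ ⬝ᵥ φ)) {g : (Tor M → ℝ) → ℝ} (hgm : Measurable g) (hgb : ∀ φ, |g φ| ≤ G) :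
    HasDerivAt (fun u => ∫ φ : Tor M → ℝ, Real.exp (-(φ ⬝ᵥ ((Δ + u • D) *ᵥ φ) / 2)) * g φ)
      (∫ φ : Tor M → ℝ, -(φ ⬝ᵥ (D *ᵥ φ) / 2) * Real.exp (-(φ ⬝ᵥ ((Δ + u₀ • D) *ᵥ φ) / 2)) * g φ) u₀ := by
  have hu₀ : u₀ ∈ s := mem_of_mem_nhds hs
  have hmeas : ∀ u : ℝ, Measurable fun φ : Tor M → ℝ => Real.exp (-(φ ⬝ᵥ ((Δ + u • D) *ᵥ φ) / 2)) * g φ :=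
    fun u => (Real.measurable_exp.comp ((measurable_dotProduct_mulVec M _).div_const 2).neg).mul hgm
  have hmeas' : ∀ u : ℝ, Measurable fun φ : Tor M → ℝ =>
      -(φ ⬝ᵥ (D *ᵥ φ) / 2) * Real.exp (-(φ ⬝ᵥ ((Δ + u • D) *ᵥ φ) / 2)) * g φ :=
    fun u => ((((measurable_dotProduct_mulVec M D).div_const 2).neg).mul
      (Real.measurable_exp.comp ((measurable_dotProduct_mulVec M _).div_const 2).neg)).mul hgm
  refine (hasDerivAt_integral_of_dominated_loc_of_deriv_le
    (F := fun u φ => Real.exp (-(φ ⬝ᵥ ((Δ + u • D) *ᵥ φ) / 2)) * g φ)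
    (F' := fun u φ => -(φ ⬝ᵥ (D *ᵥ φ) / 2) * Real.exp (-(φ ⬝ᵥ ((Δ + u • D) *ᵥ φ) / 2)) * g φ)
    (bound := fun φ => 2 * κ * G / γ * Real.exp (-(γ / 2 * (φ ⬝ᵥ φ) / 2))) hs
    (Eventually.of_forall fun u => (hmeas u).aestronglyMeasurable) ?_ (hmeas' u₀).aestronglyMeasurable ?_ ?_ ?_).2
  · exact (integrable_exp_neg_action M hγ (hco u₀ hu₀)).mul_bdd hgm.aestronglyMeasurable
      (Eventually.of_forall fun φ => by rw [Real.norm_eq_abs]; exact hgb φ)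
  · exact Eventually.of_forall fun φ u hu => by
      rw [Real.norm_eq_abs]
      exact abs_deriv_integrand_le M hγ hκ (hco u hu) hD hgb φ
  · exact (integrable_exp_neg_mul_dotProduct M (half_pos hγ)).const_mul _
  · refine Eventually.of_forall fun φ u _ => ?_
    have hlin : HasDerivAt (fun v : ℝ => -(φ ⬝ᵥ (D *ᵥ φ) / 2) * v + -(φ ⬝ᵥ (Δ *ᵥ φ) / 2))
        (-(φ ⬝ᵥ (D *ᵥ φ) / 2) * 1) u := ((hasDerivAt_id' u).const_mul _).add_const _
    have hexp : HasDerivAt (fun v : ℝ => -(φ ⬝ᵥ ((Δ + v • D) *ᵥ φ) / 2)) (-(φ ⬝ᵥ (D *ᵥ φ) / 2)) u := by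
      refine (hlin.congr_of_eventuallyEq (Eventually.of_forall fun v => ?_)).congr_deriv (mul_one _)
      simp only [dotProduct_add_smul_mulVec M]
      ring
    exact (hexp.exp.mul_const (g φ)).congr_deriv (by ring)

/-- **CONTINUITY OF THE PATH PARTITION FUNCTION** on any set of parameters where the actions are uniformly coercive [folklore; Mathlib `continuousOn_of_dominated`]. -/
theorem continuousOn_integral_exp_neg_pathAction {Δ D : Matrix (Tor M) (Tor M) ℝ} {γ G : ℝ} {s : Set ℝ} (hγ : 0 < γ)
    (hco : ∀ u ∈ s, Coercive (Δ + u • D) γ) {g : (Tor M → ℝ) → ℝ} (hgm : Measurable g) (hgb : ∀ φ, |g φ| ≤ G) :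
    ContinuousOn (fun u => ∫ φ : Tor M → ℝ, Real.exp (-(φ ⬝ᵥ ((Δ + u • D) *ᵥ φ) / 2)) * g φ) s := by
  have hmeas : ∀ u : ℝ, Measurable fun φ : Tor M → ℝ => Real.exp (-(φ ⬝ᵥ ((Δ + u • D) *ᵥ φ) / 2)) * g φ :=
    fun u => (Real.measurable_exp.comp ((measurable_dotProduct_mulVec M _).div_const 2).neg).mul hgm
  refine continuousOn_of_dominated (bound := fun φ => G * Real.exp (-(γ * (φ ⬝ᵥ φ) / 2)))
    (fun u _ => (hmeas u).aestronglyMeasurable) (fun u hu => Eventually.of_forall fun φ => ?_)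
    ((integrable_exp_neg_mul_dotProduct M hγ).const_mul G) (Eventually.of_forall fun φ => ?_)
  · have hS : γ * (φ ⬝ᵥ φ) ≤ φ ⬝ᵥ ((Δ + u • D) *ᵥ φ) := hco u hu φ
    rw [Real.norm_eq_abs, abs_mul, Real.abs_exp, mul_comm]
    exact mul_le_mul (hgb φ) (Real.exp_le_exp.2 (by linarith)) (Real.exp_pos _).le ((abs_nonneg _).trans (hgb φ))
  · have hc : Continuous fun u : ℝ => Real.exp (-((φ ⬝ᵥ (Δ *ᵥ φ) + u * (φ ⬝ᵥ (D *ᵥ φ))) / 2)) * g φ := by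
      fun_prop
    simp only [dotProduct_add_smul_mulVec M]
    exact hc.continuousOn

end FeynmanHellmann

/-! ## §3 Equipartition: the mean action of a centred Gaussian is the dimension -/
section Equipartition

/-- **★★ EQUIPARTITION** [folklore]: for a `γ`-coercive (`γ > 0`) real matrix `Δ` on the finite lattice `Tor M`,
`∫ (φ·Δφ)·e^{−½φ·Δφ} dφ = |Tor M| · ∫ e^{−½φ·Δφ} dφ` — the Gaussian mean of the action is the number of degrees of freedom.  Proof: the scaling identity
`∫ e^{−c²φ·Δφ∕2}dφ = c^{−|Tor M|}·∫ e^{−φ·Δφ∕2}dφ` (Mathlib `Measure.integral_comp_smul`) differentiated at `c = 1`, against Feynman–Hellmann (§2) for the ray `u ↦ uΔ` composed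
with `c ↦ c²`, and uniqueness of the derivative. -/
theorem integral_action_mul_exp_neg_action {Δ : Matrix (Tor M) (Tor M) ℝ} {γ : ℝ} (hγ : 0 < γ) (hc : Coercive Δ γ) :
    ∫ φ : Tor M → ℝ, φ ⬝ᵥ (Δ *ᵥ φ) * Real.exp (-(φ ⬝ᵥ (Δ *ᵥ φ) / 2))
      = Fintype.card (Tor M) * ∫ φ : Tor M → ℝ, Real.exp (-(φ ⬝ᵥ (Δ *ᵥ φ) / 2)) := by
  set F1 : ℝ := ∫ φ : Tor M → ℝ, Real.exp (-(φ ⬝ᵥ (Δ *ᵥ φ) / 2)) with hF1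
  set K : ℝ := ∫ φ : Tor M → ℝ, φ ⬝ᵥ (Δ *ᵥ φ) * Real.exp (-(φ ⬝ᵥ (Δ *ᵥ φ) / 2)) with hK
  -- (1) Feynman–Hellmann at `u₀ = 1` for the ray `u ↦ 0 + u•Δ`, coercive with `γ/2` on `u > 1/2`
  have hray : ∀ u ∈ Set.Ioi (1 / 2 : ℝ), Coercive ((0 : Matrix (Tor M) (Tor M) ℝ) + u • Δ) (γ / 2) := fun u hu φ => by
    rw [dotProduct_add_smul_mulVec M, Matrix.zero_mulVec, dotProduct_zero, zero_add]
    have h1 := hc φ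
    have h0 := dotProduct_self_nonneg_real φ
    have hS0 : 0 ≤ φ ⬝ᵥ (Δ *ᵥ φ) := (mul_nonneg hγ.le h0).trans h1
    have hu' : (1 / 2 : ℝ) < u := hu
    nlinarith [mul_nonneg (sub_nonneg.2 hu'.le) hS0]
  have hκ : 0 ≤ ∑ x, ∑ y, |Δ x y| := Finset.sum_nonneg fun x _ => Finset.sum_nonneg fun y _ => abs_nonneg _
  have hFH : HasDerivAt (fun u : ℝ => ∫ φ : Tor M → ℝ, Real.exp (-(u * (φ ⬝ᵥ (Δ *ᵥ φ)) / 2)))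
      (∫ φ : Tor M → ℝ, -(φ ⬝ᵥ (Δ *ᵥ φ) / 2) * Real.exp (-(φ ⬝ᵥ (Δ *ᵥ φ) / 2))) 1 := by
    have h := hasDerivAt_integral_exp_neg_pathAction M (half_pos hγ) hκ (Ioi_mem_nhds (by norm_num : (1 / 2 : ℝ) < 1)) hray
      (abs_dotProduct_mulVec_le M Δ) (g := fun _ => (1 : ℝ)) measurable_const (fun _ => le_of_eq abs_one)
    simpa only [zero_add, dotProduct_smul_mulVec M, one_smul, one_mul, mul_one] using h
  have hΦ' : ∫ φ : Tor M → ℝ, -(φ ⬝ᵥ (Δ *ᵥ φ) / 2) * Real.exp (-(φ ⬝ᵥ (Δ *ᵥ φ) / 2)) = -(1 / 2) * K := by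
    rw [hK, ← integral_const_mul]
    refine integral_congr_ae (Eventually.of_forall fun φ => ?_)
    simp only
    ring
  rw [hΦ'] at hFH
  -- (2) compose with `c ↦ c²`
  have hsq : HasDerivAt (fun x : ℝ => x ^ 2) 2 1 := by
    simpa using hasDerivAt_pow 2 (1 : ℝ)
  have hcomp := hFH.comp_of_eq (1 : ℝ) hsq (by norm_num)
  -- (3) the scaling identity on `c > 0`
  have hscale : ∀ c : ℝ, 0 < c →
      ((fun u : ℝ => ∫ φ : Tor M → ℝ, Real.exp (-(u * (φ ⬝ᵥ (Δ *ᵥ φ)) / 2))) ∘ fun x : ℝ => x ^ 2) c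
        = (c ^ Fintype.card (Tor M))⁻¹ * F1 := by
    intro c hc0
    have hfun : (fun φ : Tor M → ℝ => Real.exp (-(c ^ 2 * (φ ⬝ᵥ (Δ *ᵥ φ)) / 2)))
        = fun φ => (fun ψ : Tor M → ℝ => Real.exp (-(ψ ⬝ᵥ (Δ *ᵥ ψ) / 2))) (c • φ) := by
      funext φ
      simp only
      rw [dotProduct_mulVec_smul M Δ c φ]
    simp only [Function.comp_apply]
    rw [hfun, Measure.integral_comp_smul volume (fun ψ : Tor M → ℝ => Real.exp (-(ψ ⬝ᵥ (Δ *ᵥ ψ) / 2))) c]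
    rw [Module.finrank_fintype_fun_eq_card, smul_eq_mul, abs_of_pos (inv_pos.2 (pow_pos hc0 _))]
  -- (4) the explicit derivative of the scaled side at `c = 1`
  have hpow : HasDerivAt (fun c : ℝ => (c ^ Fintype.card (Tor M))⁻¹ * F1) (-(Fintype.card (Tor M) : ℝ) * F1) 1 := by
    have h := ((hasDerivAt_pow (Fintype.card (Tor M)) (1 : ℝ)).fun_inv (by simp)).mul_const F1
    simp (config := { failIfUnchanged := false }) only [one_pow, mul_one, div_one] at h
    exact h
  -- (5) the two functions agree near `c = 1`; uniqueness of the derivative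
  have hEq : (fun c : ℝ => (c ^ Fintype.card (Tor M))⁻¹ * F1)
      =ᶠ[𝓝 (1 : ℝ)] ((fun u : ℝ => ∫ φ : Tor M → ℝ, Real.exp (-(u * (φ ⬝ᵥ (Δ *ᵥ φ)) / 2))) ∘ fun x : ℝ => x ^ 2) :=
    (eventually_gt_nhds one_pos).mono fun c hc0 => (hscale c hc0).symm
  have huniq := hpow.unique (hcomp.congr_of_eventuallyEq hEq)
  -- huniq : -card * F1 = -(1/2) * K * 2
  linarith

end Equipartition

end Summit.QuantumFields.YangMills.BalabanUVNodes.N19TiltPathGaussian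

end
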